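import Mathlib
import Summits.ValiantsHypothesis.ValiantsHypothesis.Theorems.BarrierLeverPartitionMinorsHitByVPHiddenStatesSecondShellMaster
import Summits.ValiantsHypothesis.ValiantsHypothesis.Theorems.BarrierLeverPartitionMinorsHitByVPHiddenStatesSecondShellConfigurations

/-!
# Route BarrierLever — item `PartitionMinorsHitByVP` (stmt-ValiantsHypothesis-19717), line `hidden-states`:
# ★★ THE CANCELLATION TO REDUCED CONFIGURATIONS AND THE TABLE-FREE VANISHING CRITERION FOR CROSS MINORS

Helper file (`--supports stmt-ValiantsHypothesis-19717`; cell valiant-natproofs, 𝒟-side door (c), registered line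
`Cruxes/PartitionMinorsHitByVP/Lines/hidden_states.lean` v9; prover seat val-np-p6 gen 19).  Closes NO item.  Transparent
definitions only (`cfgActiveSet`, `cfgSwap`).

THE MECHANISM (memo HOME/val-np-p6/g19/MEMO-valnp6-g19.md, Theorem C).  In a configuration `(f, g)` of `…SecondShellConfigurations`
a token `u ∈ C' ∖ A` is ACTIVE when it is non-colliding (`f u ∉ f(C' − u)`) and exactly one of `f u`, `g u` equals `u`.  Swapping
`f u ↔ g u` at the LARGEST active token (★ `cfgSwap_spec`: validity preserved, active set unchanged, weight reversed) is a
sign-reversing involution, so the master sum is the signed count of the REDUCED configurations (no active token) —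
★★ `master_sum_eq_sum_reduced`; with `…SecondShellMaster.det_eq_zero_of_master` this gives the TABLE-FREE criterion
★★ `det_eq_zero_of_no_reduced`: if every configuration along the edges of an acyclic table has an active token, the cross minor
`D(A ← C')` vanishes.  Special cases: `det_eq_zero_of_chain₃/₄/₄'` (chains), the two-chains lemma, trapped/unfed tokens.

HONEST LABEL: conjecture-column toolkit (second shell, every `t, h`); 19717 stays OPEN; nothing on crux 14610 or VP ≠ VNP.
-/

set_option linter.dupNamespace false

namespace Summit.ValiantsHypothesis.ValiantsHypothesis.Theorems.BarrierLever.HiddenStates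

open Finset

noncomputable section

namespace SecondShell

variable {ι : Type} [Fintype ι] [DecidableEq ι]

/-! ## Active tokens and the swap -/

/-- the ACTIVE tokens of a configuration: `u ∈ C' ∖ A`, non-colliding, and exactly one of `f u`, `g u` equals `u`. -/
def cfgActiveSet (C' A : Finset ι) (p : (ι → ι) × (ι → ι)) : Finset ι :=
  (C' \ A).filter fun u => p.1 u ∉ (C'.erase u).image p.1 ∧ (p.1 u = u ↔ p.2 u ≠ u)

omit [Fintype ι] in
/-- membership in the active set. -/
theorem mem_cfgActiveSet {C' A : Finset ι} {p : (ι → ι) × (ι → ι)} {u : ι} :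
    u ∈ cfgActiveSet C' A p ↔ (u ∈ C' ∧ u ∉ A) ∧ p.1 u ∉ (C'.erase u).image p.1 ∧ (p.1 u = u ↔ p.2 u ≠ u) := by
  unfold cfgActiveSet; rw [Finset.mem_filter, Finset.mem_sdiff]

/-- the swap of the first step and the path successor at `u`. -/
def cfgSwap (p : (ι → ι) × (ι → ι)) (u : ι) : (ι → ι) × (ι → ι) :=
  (Function.update p.1 u (p.2 u), Function.update p.2 u (p.1 u))

omit [Fintype ι] in
/-- swapping twice at the same token is the identity. -/
theorem cfgSwap_swap (p : (ι → ι) × (ι → ι)) (u : ι) : cfgSwap (cfgSwap p u) u = p := by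
  unfold cfgSwap
  ext x <;> simp only [Function.update_self] <;> by_cases hx : x = u
  · subst hx; simp
  · simp [Function.update_of_ne hx]
  · subst hx; simp
  · simp [Function.update_of_ne hx]

/-- the non-fixed points after changing one value. -/
theorem mov_update (g : ι → ι) (u c : ι) :
    mov (Function.update g u c) = if c = u then (mov g).erase u else insert u (mov g) := by
  ext x
  by_cases hx : x = u
  · subst hx
    split_ifs with hc
    · simp [mem_mov, hc]
    · simp [mem_mov, hc]
  · split_ifs with hc
    · simp [mem_mov, hx]
    · simp [mem_mov, hx]

omit [Fintype ι] in
/-- the image of a set after changing the value at one of its points. -/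
theorem image_update_of_mem {C' : Finset ι} {u : ι} (hu : u ∈ C') (f : ι → ι) (c : ι) :
    C'.image (Function.update f u c) = insert c ((C'.erase u).image f) := by
  conv_lhs => rw [← Finset.insert_erase hu]
  rw [Finset.image_insert, Function.update_self]
  congr 1
  exact Finset.image_congr fun x hx => by
    rw [Finset.mem_coe, Finset.mem_erase] at hx; exact Function.update_of_ne hx.1 _ _

omit [Fintype ι] in
/-- the image of a set, one point singled out. -/
theorem image_eq_insert_of_mem {C' : Finset ι} {u : ι} (hu : u ∈ C') (f : ι → ι) :
    C'.image f = insert (f u) ((C'.erase u).image f) := by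
  conv_lhs => rw [← Finset.insert_erase hu]
  rw [Finset.image_insert]

/-- ★ **the swap at an active token**: validity is preserved, the active set is unchanged, the weight flips its sign. -/
theorem cfgSwap_spec (w : ι → ι → ℂ) (hdiag : ∀ u, w u u = 1) {C' A : Finset ι} {t : ℕ} (hA : A.card = t)
    {p : (ι → ι) × (ι → ι)} (hp : p ∈ cfgSet C' A t) {u : ι} (hu : u ∈ cfgActiveSet C' A p) :
    cfgSwap p u ∈ cfgSet C' A t ∧ cfgActiveSet C' A (cfgSwap p u) = cfgActiveSet C' A p ∧
      cfgWeight w C' (cfgSwap p u) = -cfgWeight w C' p ∧ cfgSwap p u ≠ p := by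
  obtain ⟨f, g⟩ := p
  obtain ⟨hfC, hcard, hdisj, hSU, himg⟩ := mem_cfgSet.1 hp
  obtain ⟨⟨huC, huA⟩, hnc, hxor⟩ := mem_cfgActiveSet.1 hu
  simp only at hfC hcard hdisj hSU himg hnc hxor
  set a := f u with ha
  set b := g u with hb
  set I₀ := (C'.erase u).image f with hI₀
  have hS : C'.image f = insert a I₀ := image_eq_insert_of_mem huC f
  have haI₀ : a ∉ I₀ := hnc
  have hI₀c : I₀.card + 1 = t := by rw [← hcard, hS, Finset.card_insert_of_notMem haI₀]
  -- `g` is injective on `mov g` (as many images as vertices, `|A| = t = |S|`)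
  have hinj : Set.InjOn g ↑(mov g) := by
    rw [← Finset.card_image_iff, himg, Finset.card_sdiff_of_subset hSU, Finset.card_union_of_disjoint hdisj.symm, hA, hcard]
    omega
  have hbS : u ∈ mov g → b ∉ C'.image f := fun hum hbS' => by
    have : b ∈ (mov g).image g := Finset.mem_image_of_mem g hum
    rw [himg] at this
    exact (Finset.mem_sdiff.1 this).2 hbS'
  have huS : u ∉ mov g → u ∉ C'.image f := fun hum huS' => by
    rcases Finset.mem_union.1 (hSU huS') with h | h
    · exact huA h
    · exact hum h
  -- the swapped configuration
  have hf' : (cfgSwap (f, g) u).1 = Function.update f u b := rfl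
  have hg' : (cfgSwap (f, g) u).2 = Function.update g u a := rfl
  have hS' : C'.image (Function.update f u b) = insert b I₀ := image_update_of_mem huC f b
  have hI₀' : (C'.erase u).image (Function.update f u b) = I₀ :=
    Finset.image_congr fun x hx => by
      rw [Finset.mem_coe, Finset.mem_erase] at hx; exact Function.update_of_ne hx.1 _ _
  have hne : cfgSwap (f, g) u ≠ (f, g) := by
    intro h
    have h1 : Function.update f u b u = f u := by rw [← hf', h]
    rw [Function.update_self] at h1
    -- `a = b` contradicts «exactly one of them is `u`»
    by_cases hau : a = u
    · exact (hxor.1 hau) (h1.trans hau)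
    · exact hau (h1.symm.trans (not_not.1 (fun hbu => hau ((hxor.2 hbu)))))
  -- the two cases
  by_cases hau : a = u
  · -- FORWARD: `f u = u`, `g u = b ≠ u`
    have hbu : b ≠ u := hxor.1 hau
    have hum : u ∈ mov g := mem_mov.2 hbu
    have hbI₀ : b ∉ I₀ := fun h => hbS hum (hS ▸ Finset.mem_insert_of_mem h)
    have hmov' : mov (Function.update g u a) = (mov g).erase u := by rw [mov_update, if_pos hau]
    refine ⟨?_, ?_, ?_, hne⟩
    · -- validity
      rw [mem_cfgSet, hf', hg', hS', hmov']
      refine ⟨mem_fnOn.2 fun x hx => ?_, ?_, ?_, ?_, ?_⟩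
      · rw [Function.update_of_ne (fun h => hx (by rw [h]; exact huC))]; exact (mem_fnOn.1 hfC) x hx
      · rw [Finset.card_insert_of_notMem hbI₀, hI₀c]
      · exact Finset.disjoint_of_subset_left (Finset.erase_subset _ _) hdisj
      · intro x hx
        rcases Finset.mem_insert.1 hx with rfl | hx
        · have : g u ∈ (mov g).image g := Finset.mem_image_of_mem g hum
          rw [himg] at this
          obtain ⟨h1, -⟩ := Finset.mem_sdiff.1 this
          rcases Finset.mem_union.1 h1 with h1 | h1
          · exact Finset.mem_union_left _ h1
          · exact Finset.mem_union_right _ (Finset.mem_erase.2 ⟨hbu, h1⟩)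
        · have hxS : x ∈ C'.image f := hS ▸ Finset.mem_insert_of_mem hx
          have hxu : x ≠ u := fun h => haI₀ (by rw [hau, ← h]; exact hx)
          rcases Finset.mem_union.1 (hSU hxS) with h1 | h1
          · exact Finset.mem_union_left _ h1
          · exact Finset.mem_union_right _ (Finset.mem_erase.2 ⟨hxu, h1⟩)
      · -- images: remove the path edge `u → b`
        ext x
        simp only [Finset.mem_image, Finset.mem_sdiff, Finset.mem_union, Finset.mem_erase, Finset.mem_insert]
        constructor
        · rintro ⟨y, ⟨hyu, hy⟩, rfl⟩
          rw [Function.update_of_ne hyu]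
          have hgy : g y ∈ (mov g).image g := Finset.mem_image_of_mem g hy
          rw [himg, Finset.mem_sdiff, Finset.mem_union, hS, Finset.mem_insert] at hgy
          obtain ⟨h1, h2⟩ := hgy
          refine ⟨?_, ?_⟩
          · rcases h1 with h1 | h1
            · exact Or.inl h1
            · refine Or.inr ⟨fun h => ?_, h1⟩
              exact h2 (Or.inl (h.trans hau.symm))
          · rintro (h | h)
            · exact hyu (hinj (Finset.mem_coe.2 hy) (Finset.mem_coe.2 hum) h)
            · exact h2 (Or.inr h)
        · rintro ⟨h1, h2⟩
          have hxb : x ≠ b := fun h => h2 (Or.inl h)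
          have hxI : x ∉ I₀ := fun h => h2 (Or.inr h)
          have hxu : x ≠ u := by
            rintro rfl
            rcases h1 with h1 | ⟨h1, -⟩
            · exact huA h1
            · exact h1 rfl
          have hx' : x ∈ (A ∪ mov g) \ C'.image f := by
            rw [Finset.mem_sdiff, Finset.mem_union, hS, Finset.mem_insert, hau]
            exact ⟨h1.imp id And.right, fun h => h.elim hxu hxI⟩
          rw [← himg, Finset.mem_image] at hx'
          obtain ⟨y, hy, rfl⟩ := hx'
          have hyu : y ≠ u := fun h => hxb (by rw [h])
          exact ⟨y, ⟨hyu, hy⟩, by rw [Function.update_of_ne hyu]⟩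
    · -- the active set is unchanged
      ext x
      rw [mem_cfgActiveSet, mem_cfgActiveSet, hf', hg']
      by_cases hxu : x = u
      · subst hxu
        simp only [Function.update_self, hI₀']
        rw [← hI₀]
        constructor
        · intro _; exact ⟨⟨huC, huA⟩, hnc, hxor⟩
        · intro _; exact ⟨⟨huC, huA⟩, hbI₀, ⟨fun h => absurd h hbu, fun h => absurd hau h⟩⟩
      · simp only [Function.update_of_ne hxu]
        have himg_x : x ∈ C' → (f x ∈ (C'.erase x).image (Function.update f u b) ↔ f x ∈ (C'.erase x).image f) := by
          intro hxC
          have hux : u ∈ C'.erase x := Finset.mem_erase.2 ⟨Ne.symm hxu, huC⟩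
          rw [image_update_of_mem hux, image_eq_insert_of_mem hux f, Finset.mem_insert, Finset.mem_insert]
          have hfxb : f x ≠ b := fun h => hbS hum (h ▸ Finset.mem_image_of_mem f hxC)
          have hfxa : f x ≠ f u := fun h => hnc (by rw [ha, ← h]; exact Finset.mem_image_of_mem f (Finset.mem_erase.2 ⟨hxu, hxC⟩))
          constructor
          · rintro (h | h)
            · exact absurd h hfxb
            · exact Or.inr h
          · rintro (h | h)
            · exact absurd h hfxa
            · exact Or.inr h
        constructor
        · rintro ⟨⟨hxC, hxA⟩, h2, h3⟩; exact ⟨⟨hxC, hxA⟩, fun h => h2 ((himg_x hxC).2 h), h3⟩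
        · rintro ⟨⟨hxC, hxA⟩, h2, h3⟩; exact ⟨⟨hxC, hxA⟩, fun h => h2 ((himg_x hxC).1 h), h3⟩
    · -- the weight flips
      unfold cfgWeight
      rw [hf', hg', hmov']
      simp only
      rw [← Finset.mul_prod_erase C' _ huC, ← Finset.mul_prod_erase C' (fun x => w x (f x)) huC,
        ← Finset.mul_prod_erase (mov g) (fun x => w x (g x)) hum, Function.update_self]
      rw [Finset.prod_congr rfl (fun x hx => by rw [Function.update_of_ne (Finset.ne_of_mem_erase hx)]),
        Finset.prod_congr rfl (fun x (hx : x ∈ (mov g).erase u) => by rw [Function.update_of_ne (Finset.ne_of_mem_erase hx)])]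
      rw [← ha, ← hb, hau, hdiag, Finset.card_erase_of_mem hum]
      have hm : (mov g).card = ((mov g).card - 1) + 1 := by have := Finset.card_pos.2 ⟨u, hum⟩; omega
      conv_rhs => rw [hm, pow_succ]
      ring
  · -- BACKWARD: `f u = a ≠ u`, `g u = u`
    have hbu : b = u := by by_contra h; exact hau (hxor.2 h)
    have hum : u ∉ mov g := fun h => (mem_mov.1 h) hbu
    have huS' : u ∉ C'.image f := huS hum
    have huI₀ : u ∉ I₀ := fun h => huS' (hS ▸ Finset.mem_insert_of_mem h)
    have hmov' : mov (Function.update g u a) = insert u (mov g) := by rw [mov_update, if_neg hau]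
    have haAU : a ∈ A ∪ mov g := hSU (hS ▸ Finset.mem_insert_self a I₀)
    refine ⟨?_, ?_, ?_, hne⟩
    · -- validity
      rw [mem_cfgSet, hf', hg', hS', hmov', hbu]
      refine ⟨mem_fnOn.2 fun x hx => ?_, ?_, ?_, ?_, ?_⟩
      · rw [Function.update_of_ne (fun h => hx (by rw [h]; exact huC))]; exact (mem_fnOn.1 hfC) x hx
      · rw [Finset.card_insert_of_notMem huI₀, hI₀c]
      · rw [Finset.disjoint_insert_left]; exact ⟨huA, hdisj⟩
      · intro x hx
        rcases Finset.mem_insert.1 hx with rfl | hx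
        · exact Finset.mem_union_right _ (Finset.mem_insert_self _ _)
        · have hxS : x ∈ C'.image f := hS ▸ Finset.mem_insert_of_mem hx
          rcases Finset.mem_union.1 (hSU hxS) with h1 | h1
          · exact Finset.mem_union_left _ h1
          · exact Finset.mem_union_right _ (Finset.mem_insert_of_mem h1)
      · -- images: add the path edge `u → a`
        rw [Finset.image_insert, Function.update_self]
        rw [Finset.image_congr (show Set.EqOn (Function.update g u a) g ↑(mov g) from fun x hx =>
          Function.update_of_ne (fun h => hum (by rw [← h]; exact Finset.mem_coe.1 hx)) _ _), himg, hS]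
        ext x
        simp only [Finset.mem_insert, Finset.mem_sdiff, Finset.mem_union]
        constructor
        · rintro (rfl | ⟨h1, h2⟩)
          · refine ⟨?_, fun h => h.elim hau haI₀⟩
            rcases Finset.mem_union.1 haAU with h | h
            · exact Or.inl h
            · exact Or.inr (Or.inr h)
          · refine ⟨h1.imp id Or.inr, fun h => ?_⟩
            rcases h with rfl | h
            · rcases h1 with h1 | h1
              · exact huA h1
              · exact hum h1
            · exact h2 (Or.inr h)
        · rintro ⟨h1, h2⟩
          by_cases hxa : x = a
          · exact Or.inl hxa
          · right
            refine ⟨?_, fun h => h.elim hxa (fun h' => h2 (Or.inr h'))⟩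
            rcases h1 with h1 | h1 | h1
            · exact Or.inl h1
            · exact absurd (Or.inl h1) h2
            · exact Or.inr h1
    · -- the active set is unchanged
      ext x
      rw [mem_cfgActiveSet, mem_cfgActiveSet, hf', hg']
      by_cases hxu : x = u
      · subst hxu
        simp only [Function.update_self, hI₀']
        rw [← hI₀]
        constructor
        · intro _; exact ⟨⟨huC, huA⟩, hnc, hxor⟩
        · intro _; refine ⟨⟨huC, huA⟩, hbu ▸ huI₀, ⟨fun _ => hau, fun _ => hbu⟩⟩
      · simp only [Function.update_of_ne hxu]
        have himg_x : x ∈ C' → (f x ∈ (C'.erase x).image (Function.update f u b) ↔ f x ∈ (C'.erase x).image f) := by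
          intro hxC
          have hux : u ∈ C'.erase x := Finset.mem_erase.2 ⟨Ne.symm hxu, huC⟩
          rw [image_update_of_mem hux, image_eq_insert_of_mem hux f, Finset.mem_insert, Finset.mem_insert]
          have hfxb : f x ≠ b := fun h => huS' (hbu ▸ h ▸ Finset.mem_image_of_mem f hxC)
          have hfxa : f x ≠ f u := fun h => hnc (by rw [ha, ← h]; exact Finset.mem_image_of_mem f (Finset.mem_erase.2 ⟨hxu, hxC⟩))
          constructor
          · rintro (h | h)
            · exact absurd h hfxb
            · exact Or.inr h
          · rintro (h | h)
            · exact absurd h hfxa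
            · exact Or.inr h
        constructor
        · rintro ⟨⟨hxC, hxA⟩, h2, h3⟩; exact ⟨⟨hxC, hxA⟩, fun h => h2 ((himg_x hxC).2 h), h3⟩
        · rintro ⟨⟨hxC, hxA⟩, h2, h3⟩; exact ⟨⟨hxC, hxA⟩, fun h => h2 ((himg_x hxC).1 h), h3⟩
    · -- the weight flips
      unfold cfgWeight
      rw [hf', hg', hmov']
      simp only
      rw [← Finset.mul_prod_erase C' _ huC, ← Finset.mul_prod_erase C' (fun x => w x (f x)) huC,
        Finset.prod_insert hum, Function.update_self, Function.update_self]
      rw [Finset.prod_congr rfl (fun x hx => by rw [Function.update_of_ne (Finset.ne_of_mem_erase hx)]),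
        Finset.prod_congr rfl (fun x (hx : x ∈ mov g) => by rw [Function.update_of_ne (fun h => hum (by rw [← h]; exact hx))])]
      rw [← ha, hbu, hdiag, Finset.card_insert_of_notMem hum, pow_succ]
      ring

/-! ## ★★ Theorem C — the cancellation and the table-free criterion -/

/-- ★★ **THE MASTER SUM IS THE SIGNED COUNT OF REDUCED CONFIGURATIONS** (no active token). -/
theorem master_sum_eq_sum_reduced [LinearOrder ι] (w : ι → ι → ℂ) (hdiag : ∀ u, w u u = 1)
    (C' A : Finset ι) (t : ℕ) (hA : A.card = t) :
    ∑ S ∈ (Finset.univ : Finset ι).powersetCard t, sur w C' S * dps w Finset.univ S A =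
      ∑ p ∈ (cfgSet C' A t).filter (fun p => cfgActiveSet C' A p = ∅), cfgWeight w C' p := by
  classical
  rw [master_sum_eq_sum_cfg, ← Finset.sum_filter_add_sum_filter_not (cfgSet C' A t) (fun p => cfgActiveSet C' A p = ∅),
    add_eq_left]
  -- the involution on the configurations with an active token
  refine Finset.sum_involution (fun p hp => cfgSwap p ((cfgActiveSet C' A p).max'
    (Finset.nonempty_iff_ne_empty.2 (Finset.mem_filter.1 hp).2))) ?_ ?_ ?_ ?_
  · intro p hp
    obtain ⟨hp1, hp2⟩ := Finset.mem_filter.1 hp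
    have hne := Finset.nonempty_iff_ne_empty.2 hp2
    obtain ⟨-, -, hwt, -⟩ := cfgSwap_spec w hdiag hA hp1 (Finset.max'_mem _ hne)
    rw [hwt]; ring
  · intro p hp _
    obtain ⟨hp1, hp2⟩ := Finset.mem_filter.1 hp
    have hne := Finset.nonempty_iff_ne_empty.2 hp2
    exact (cfgSwap_spec w hdiag hA hp1 (Finset.max'_mem _ hne)).2.2.2
  · intro p hp
    obtain ⟨hp1, hp2⟩ := Finset.mem_filter.1 hp
    have hne := Finset.nonempty_iff_ne_empty.2 hp2
    obtain ⟨hval, hact, -, -⟩ := cfgSwap_spec w hdiag hA hp1 (Finset.max'_mem _ hne)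
    exact Finset.mem_filter.2 ⟨hval, by rw [hact]; exact hp2⟩
  · intro p hp
    obtain ⟨hp1, hp2⟩ := Finset.mem_filter.1 hp
    have hne := Finset.nonempty_iff_ne_empty.2 hp2
    obtain ⟨-, hact, -, -⟩ := cfgSwap_spec w hdiag hA hp1 (Finset.max'_mem _ hne)
    simp only [hact]
    exact cfgSwap_swap p _

/-- ★★ **THE TABLE-FREE VANISHING CRITERION.**  Acyclic table with unit diagonal; cross minor `D(A ← C')` in key form.  If every
configuration `(f, g)` ALONG THE EDGES of the table — `f` = first steps of the tokens of `C'` (`f u = u` or an edge `u → f u`,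
identity off `C'`, `|f(C')| = t`), `g` = successor map of a path system from `f(C')` onto `A` (`g u ≠ u` exactly on the non-terminal
path vertices `mov g`, each `u → g u` an edge, `mov g ∩ A = ∅`, `g(mov g) = (A ∪ mov g) ∖ f(C')`) — has an ACTIVE token (`u ∈ C' ∖ A`,
not colliding, with exactly one of `f u`, `g u` equal to `u`), then the cross minor vanishes. -/
theorem det_eq_zero_of_no_reduced [LinearOrder ι] (w : ι → ι → ℂ) (hdiag : ∀ u, w u u = 1) (pot : ι → ℕ)
    (hdag : ∀ u v, u ≠ v → w u v ≠ 0 → pot v < pot u)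
    (t : ℕ) {r : ℕ} (rows cols : Fin r → Finset ι) (i₀ : Fin r) (C' A : Finset ι)
    (hrow : rows i₀ = C') (hC' : C'.card = t + 1) (hA : A.card = t)
    (hall : ∀ S : Finset ι, S.card ≤ t → S ≠ A → ∃ i, i ≠ i₀ ∧ rows i = S)
    (hcol : ∀ kk, (cols kk).card ≤ t)
    (hnone : ∀ f g : ι → ι, (∀ u, u ∉ C' → f u = u) → (∀ u ∈ C', f u ≠ u → w u (f u) ≠ 0) →
      (∀ u, g u ≠ u → w u (g u) ≠ 0) → (C'.image f).card = t → Disjoint (mov g) A → C'.image f ⊆ A ∪ mov g →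
      (mov g).image g = (A ∪ mov g) \ C'.image f →
      ∃ u ∈ C', u ∉ A ∧ f u ∉ (C'.erase u).image f ∧ (f u = u ↔ g u ≠ u)) :
    (mat w rows cols).det = 0 := by
  classical
  refine det_eq_zero_of_master w hdiag pot hdag t rows cols i₀ C' A hrow hC' hA hall hcol ?_
  rw [master_sum_eq_sum_reduced w hdiag C' A t hA]
  refine Finset.sum_eq_zero fun p hp => ?_
  obtain ⟨hp1, hp2⟩ := Finset.mem_filter.1 hp
  obtain ⟨hfC, hcard, hdisj, hSU, himg⟩ := mem_cfgSet.1 hp1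
  by_contra hwt
  unfold cfgWeight at hwt
  have hf1 : ∀ u ∈ C', p.1 u ≠ u → w u (p.1 u) ≠ 0 := fun u hu _ h0 =>
    hwt (by rw [Finset.prod_eq_zero hu h0, zero_mul])
  have hg1 : ∀ u, p.2 u ≠ u → w u (p.2 u) ≠ 0 := fun u hu h0 =>
    hwt (by rw [Finset.prod_eq_zero (mem_mov.2 hu) h0, mul_zero, mul_zero])
  obtain ⟨u, huC, huA, hnc, hx⟩ := hnone p.1 p.2 (mem_fnOn.1 hfC) hf1 hg1 hcard hdisj hSU himg
  have : u ∈ cfgActiveSet C' A p := mem_cfgActiveSet.2 ⟨⟨huC, huA⟩, hnc, hx⟩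
  rw [hp2] at this
  exact Finset.notMem_empty u this

end SecondShell

end

end Summit.ValiantsHypothesis.ValiantsHypothesis.Theorems.BarrierLever.HiddenStates
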